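import Literature.MathematicalPhysics.QuantumFieldTheory.Balaban1983to89.B6RandomWalkL2Transplant
import Literature.MathematicalPhysics.QuantumFieldTheory.Balaban1983to89.B6InDecayWindowV1

/-!
# `Balaban1983to89.B6RandomWalkL2WindowV1` — T. Bałaban, *Propagators and renormalization transformations for lattice gauge theories. II*,
# Commun. Math. Phys. **96** (1984) 223–250 [Balaban1984PropagatorsII], (2.133) p. 247 with p. 238 (`T_□ = □̃³`) IN THE `L²` NORMS OF (2.140): THE BAND
# BRIDGE IN `ℓ²` — a member operator with a block-`ℓ²` majorant `A·e^{−δ|y−y′|_{T_□}}` on `T_□`, transplanted through the full window of the V1 torus, has an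
# input-localised block-`ℓ²` majorant with GLOBAL decay (the `ℓ²` twin of r03's `B6InDecayWindowV1.inDecay_window_V1`; file 7 of the block-`ℓ²` bricks)

statement-level skeleton of published theorems with citation tags; proofs where landed; nothing here is a claim about the Yang–Mills mass gap

WHAT IS PRINTED (p. 247 [PDF 25], render `inprint/lit-balaban-p05/renders/cmp96/p25.png`): *"At first we will formulate the relevant inequalities for G_□ rescaled
back to η-scale. We have |(G_□J)(x)|, |(∇G_□J)(x)| ≤ O(1)[(Lʲη)², Lʲη]e^{−δ₂(Lʲη)⁻¹dist(Δ,Δ′)}|J|, (2.133) for x ∈ Δ(y), supp J ⊂ Δ(y′), y, y′ ∈ 𝔅 ∩ T_□"*; p. 246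
Prop. 2.5: *"G_□ … satisfies all the inequalities (1.110)–(1.114)"*; p. 247 (2.141): *"convergent in the norms appearing in the inequalities (2.136)–(2.140)"*.

CITATION HEADER (lean-in-tree rule) — WHAT IS REPRODUCED.  Phase-2 file of the `lit-balaban` typed skeleton (HOME `run/shared/lean/pub/lit-balaban/`), seat
**p22 gen 29** (free-target protocol G.5-34(d), TAKING HOME/STATUS 2026-08-24T13:26Z, cc r03); SKELETON row **B6.Prop2.6** × B6.Eq2.133 × B6.Txt@238 (cells only;
decls of record untouched).  r03 g21's `B6InDecayWindowV1` factors the passage member → global torus for SUP majorants into `inMajorant_transplant` + window data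
(`injOn_chartBond_full`, `supNorm_div_le_of_band_right`, `expKernel_of_supNorm_le`, `hglob_W`, `hfib_sites_full`, `inWindow_of_mem_W`, `injOn_posV_dir`,
`transplant_eB_eq`).  THIS FILE re-runs the two top theorems with `…B6RandomWalkL2Transplant.inL2Majorant_transplant` in place of `inMajorant_transplant`, the
window data BY NAME, unchanged, after the generic bookkeeping the cube files need:
* §0 (the `ℓ²` twins of r03's `InMajorant` bookkeeping, `B6InMajorantTransplant` §1–§3 / `B6InDecayWindowV1.inMajorant_smul_of_le_on`): `inL2Majorant_congr_set`,
  `inL2Majorant_subset`, `blockPiece_smul`, **`inL2Majorant_smul_of_le_on`** (a weight valid on the output window, e.g. the unit `s(□)⁻¹ ≤ (L^{j(y)}/c′)²`),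
  `l2n_comp_equiv`, **`inL2Majorant_relabel`**, **`inL2Majorant_conj_chart`** (`τ_{−v}T₂τ_v`, reach = block-map image); §0b `hasL2Majorant_smul` and
  **`hasL2Majorant_sandwich_in`** (`f·T·h` with an input-localised middle factor, `|f| ≤ s`, `|h| ≤ 1` supported over the blocks of `S` ⟹
  `HasL2Majorant (1_S(y)1_S(y′)·s·K)` — the `ℓ²` twin of p38's `B6Prop26LeftEntryKLevelV1.hasMajorant_sandwich_in`);
* **`inL2Majorant_transplant_of_band`** — the band bridge, input-localised form, for block-`ℓ²` majorants: `HasL2Majorant (tsGeo i) (iterBlockOf j ∘ src) T′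
  (A·e^{−δ·tdist})` + window in the middle band ⇒ `InL2Majorant blk (transplant W (chartBond …) T′) S (n²·A·e^{δ(κ+c)/(κC)}·e^{−(δ/(κC))·d})`;
* **`inL2Decay_window_V1`** — fired on the V1 torus `T_η` with r03's full bond window `cB t x₀`: `InL2Majorant (geomT D) (blkV1 hN D) (transplant (cB …).W (eB …) T′) S
  ((L^{d+1})²·A·e^{2δ/C}·e^{−(δ/((d+1)C))·d_T})` — the form in which `…B6RandomWalkL2TwoScaleMembers.ineq2140_DDG_TS` (the member (1.114)₅) reaches the cubes of
  the k-level torus.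
THEOREMS ONLY (no definition, no `def … : Prop`, no new hypothesis beyond r03's); IMPORTS BY NAME, restating nothing; standard axioms.

HONEST SCOPE / DIVERGENCES.  (1) As `B6InDecayWindowV1` (inputs over `S` in the middle band, outputs anywhere; window up to the full fine period; levels `j`,
`j + 1` on the window); constant `(L^{d+1})²` where the sup twin has `L^{d+1}` (`inL2Majorant_transplant`'s `n²`).  (2) Unweighted `ℓ²` on both lattices.  (3) The
per-cube legs (`…B6RandomWalkL2Grad2LegV1`) and the gluing are the next files; toward the unowned census slots (2.140)₄₋₆,
NOT those slots.  NOT summit progress.  Unit `lit-balaban-p22` (gen 29), 2026-08-24.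
-/

noncomputable section

open scoped BigOperators
open Finset

namespace Literature.MathematicalPhysics.QuantumFieldTheory.Balaban1983to89.B6RandomWalkL2WindowV1

open B6RandomWalk (blockPiece)
open B6RandomWalkL2 (l2n l2n_nonneg l2n_sq l2n_zero l2n_smul l2n_mono HasL2Majorant)
open B6Prop26Gluing (mulOp mulOp_apply ind ind_nonneg ind_of_mem ind_of_not_mem)
open B6RandomWalkL2Transplant (InL2Majorant inL2Majorant_transplant inL2Majorant_mono)
open B6Prop26ReachTransplant (transplant chartBond InWindow injOn_chartBond_full)
open B6InDecayWindowV1 (supNorm_div_le_of_band_right expKernel_of_supNorm_le hfib_sites_full injOn_posV_dir inWindow_of_mem_W hglob_W)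
open B4ContourShift (supNorm)
open B5Eq118OneStroke (iterBlockOf)

/-! ## §0  Bookkeeping on input-localised block-`ℓ²` majorants: the input set, a weight on the output window, relabellings, the chart translation -/

section Bookkeeping

variable {g : B6.Geometry} {X : Type} [Fintype X]

/-- the input set may be replaced by one with the same members. [cite: Balaban1984PropagatorsII, (2.133) p.247 (bookkeeping, ours)] -/
theorem inL2Majorant_congr_set (blk : X → g.Site) {T : Module.End ℝ (X → ℝ)} {S S' : Set g.Site} {K : g.Site → g.Site → ℝ}
    (hS : ∀ a, a ∈ S ↔ a ∈ S') (h : InL2Majorant blk T S K) : InL2Majorant blk T S' K :=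
  fun y y' hy' u hu => h y y' ((hS y').2 hy') u hu

/-- restriction to a smaller input set. [cite: Balaban1984PropagatorsII, (2.133) p.247 (bookkeeping, ours)] -/
theorem inL2Majorant_subset (blk : X → g.Site) {T : Module.End ℝ (X → ℝ)} {S S' : Set g.Site} {K : g.Site → g.Site → ℝ}
    (h : InL2Majorant blk T S K) (hS : S' ⊆ S) : InL2Majorant blk T S' K :=
  fun y y' hy' u hu => h y y' (hS hy') u hu

omit [Fintype X] in
/-- `Δ(y)(c·f) = c·Δ(y)f`. [cite: Balaban1984PropagatorsII, (2.52) p.232 (bookkeeping, ours)] -/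
theorem blockPiece_smul (blk : X → g.Site) (y : g.Site) (c : ℝ) (f : X → ℝ) : blockPiece blk y (c • f) = c • blockPiece blk y f := by
  funext x
  by_cases hx : blk x = y <;> simp [blockPiece, hx]

/-- **SCALING WITH A WEIGHT VALID ON THE SUPPORT OF THE OUTPUTS**, block-`ℓ²` form: if `T` only produces outputs in `W` (a transplant vanishes off its
window) and `s·K(y(x), b) ≤ K′(y(x), b)` for `x ∈ W`, `b ∈ S`, then `s • T` has the input-localised block-`ℓ²` majorant `K′` (the `ℓ²` twin of r03's
`B6InDecayWindowV1.inMajorant_smul_of_le_on`; used with the unit `s(□)⁻¹` on the two-level window). [cite: Balaban1984PropagatorsII, (2.94) p.239, (2.133) + (2.140) p.247; derivation ours] -/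
theorem inL2Majorant_smul_of_le_on (blk : X → g.Site) {T : Module.End ℝ (X → ℝ)} {S : Set g.Site} {K K' : g.Site → g.Site → ℝ}
    (h : InL2Majorant blk T S K) (W : Finset X) (hW : ∀ μ x, x ∉ W → T μ x = 0) {s : ℝ} (hs : 0 ≤ s) (hK' : ∀ a b, 0 ≤ K' a b)
    (hle : ∀ x ∈ W, ∀ b ∈ S, s * K (blk x) b ≤ K' (blk x) b) : InL2Majorant blk (s • T) S K' := by
  intro y y' hy' u hu
  rw [LinearMap.smul_apply, blockPiece_smul, l2n_smul, abs_of_nonneg hs]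
  by_cases hy : ∃ x ∈ W, blk x = y
  · obtain ⟨x, hx, rfl⟩ := hy
    calc s * l2n (blockPiece blk (blk x) (T u)) ≤ s * (K (blk x) y' * l2n u) := mul_le_mul_of_nonneg_left (h _ y' hy' u hu) hs
      _ = s * K (blk x) y' * l2n u := by ring
      _ ≤ K' (blk x) y' * l2n u := mul_le_mul_of_nonneg_right (hle x hx y' hy') (l2n_nonneg u)
  · have h0 : blockPiece blk y (T u) = 0 := by
      funext x
      by_cases hx : blk x = y
      · have hxW : x ∉ W := fun hxW => hy ⟨x, hxW, hx⟩
        simp [blockPiece, hW u x hxW]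
      · simp [blockPiece, hx]
    rw [h0, l2n_zero, mul_zero]
    exact mul_nonneg (hK' _ _) (l2n_nonneg u)

/-- `‖f ∘ φ‖ = ‖f‖` for a relabelling `φ` of the lattice. [cite: Balaban1984PropagatorsII, (2.140) p.247 (bookkeeping, ours)] -/
theorem l2n_comp_equiv (φ : X ≃ X) (f : X → ℝ) : l2n (f ∘ φ) = l2n f := by
  have h : l2n (f ∘ φ) ^ 2 = l2n f ^ 2 := by
    rw [l2n_sq, l2n_sq]
    exact Equiv.sum_comp φ (fun x => f x ^ 2)
  rw [← Real.sqrt_sq (l2n_nonneg (f ∘ φ)), h, Real.sqrt_sq (l2n_nonneg f)]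

variable {g₁ g₂ : B6.Geometry}

/-- **INPUT-LOCALISED BLOCK-`ℓ²` MAJORANTS TRANSPORT ALONG A RELABELLING** (`blk₁ ∘ φ = e ∘ blk₂`, `(T₁f)(φx) = (T₂(f ∘ φ))(x)`, `S₁ = e″S₂`, `e`
injective on blocks, `φ` a bijection of the lattice: block pieces and `ℓ²` sizes correspond) — the `ℓ²` twin of r03's `B6InMajorantTransplant.inMajorant_relabel`.
[cite: Balaban1984PropagatorsII, (2.133) + (2.140) p.247, dictionary (charts); derivation ours] -/
theorem inL2Majorant_relabel (φ : X ≃ X) (e : g₂.Site → g₁.Site) (he : Function.Injective e) (blk₁ : X → g₁.Site) (blk₂ : X → g₂.Site)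
    (hblk : ∀ x, blk₁ (φ x) = e (blk₂ x)) {T₁ T₂ : Module.End ℝ (X → ℝ)} (hT : ∀ f x, T₁ f (φ x) = T₂ (f ∘ φ) x)
    {S₁ : Set g₁.Site} {S₂ : Set g₂.Site} (hS : ∀ a, e a ∈ S₁ ↔ a ∈ S₂) (hS₁ : ∀ y ∈ S₁, ∃ a, e a = y)
    {K₁ : g₁.Site → g₁.Site → ℝ} {K₂ : g₂.Site → g₂.Site → ℝ} (h₂ : InL2Majorant (g := g₂) blk₂ T₂ S₂ K₂)
    (hK : ∀ a b, K₂ a b ≤ K₁ (e a) (e b)) (hK₁ : ∀ a b, 0 ≤ K₁ a b) : InL2Majorant (g := g₁) blk₁ T₁ S₁ K₁ := by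
  intro y y' hy' u hu
  obtain ⟨b, rfl⟩ := hS₁ y' hy'
  -- the pulled-back input `u ∘ φ` is supported in the block `b`
  have hu' : ∀ x, blk₂ x ≠ b → (u ∘ φ) x = 0 := fun x hx =>
    hu (φ x) (by rw [hblk]; exact fun h' => hx (he h'))
  by_cases hy : ∃ a, e a = y
  · obtain ⟨a, rfl⟩ := hy
    have hpiece : blockPiece blk₁ (e a) (T₁ u) ∘ φ = blockPiece blk₂ a (T₂ (u ∘ φ)) := by
      funext x
      by_cases hx : blk₂ x = a <;> simp [blockPiece, hblk, he.eq_iff, hx, hT]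
    calc l2n (blockPiece blk₁ (e a) (T₁ u)) = l2n (blockPiece blk₁ (e a) (T₁ u) ∘ φ) := (l2n_comp_equiv φ _).symm
      _ = l2n (blockPiece blk₂ a (T₂ (u ∘ φ))) := by rw [hpiece]
      _ ≤ K₂ a b * l2n (u ∘ φ) := h₂ a b ((hS b).1 hy') (u ∘ φ) hu'
      _ ≤ K₁ (e a) (e b) * l2n u := by
          rw [l2n_comp_equiv]
          exact mul_le_mul_of_nonneg_right (hK a b) (l2n_nonneg u)
  · have h0 : blockPiece blk₁ y (T₁ u) = 0 := by
      funext x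
      obtain ⟨x₂, rfl⟩ := φ.surjective x
      have hne : blk₁ (φ x₂) ≠ y := by rw [hblk]; exact fun h' => hy ⟨_, h'⟩
      simp [blockPiece, hne]
    rw [h0, l2n_zero]
    exact mul_nonneg (hK₁ _ _) (l2n_nonneg u)

end Bookkeeping

section Torus

open B6TranslateTorusV1 (vch TB conj_apply blkV1_translate)
open B6GlobalChartV1 (PV blkV1)
open B6MultiLevelBoxOperator (N0)
open B6MultiLevelTorusOperator (TDomains)
open B6Geom246MultiLevelTorus (geomT blkMap blkMap_injective)

variable {d ℓ : ℕ} {hd : 1 ≤ d + 1} {hL : Odd (ℓ + 1) ∧ 1 < ℓ + 1} {m K : ℕ} {Mh k R : ℕ} {P' : Fin (d + 1) → ℕ}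
variable (hN : ∀ μ, N0 ℓ Mh k P' μ = (PV d ℓ m K hd hL).sitesPerDir 0) (D : TDomains d ℓ Mh k P' R) (hMh : 1 ≤ Mh) (hP : ∀ μ, 1 ≤ P' μ)
  (s : Fin (d + 1) → ℤ)

include hMh hP in
/-- **INPUT-LOCALISED BLOCK-`ℓ²` MAJORANTS IN THE CHART FRAME ARE ONES IN THE GLOBAL FRAME** for the conjugate `τ_{-v} T₂ τ_v` (input set carried by
p21's block map) — the `ℓ²` twin of r03's `B6InMajorantTransplant.inMajorant_conj_chart`.
[cite: Balaban1984PropagatorsII, (2.133) + (2.140) p.247 with (2.45)–(2.46) p.231, dictionary (charts); derivation ours] -/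
theorem inL2Majorant_conj_chart {T₂ : Module.End ℝ (PBond (PV d ℓ m K hd hL) 0 → ℝ)} {S : Set (geomT (D.chart s)).Site}
    {K : (geomT (D.chart s)).Site → (geomT (D.chart s)).Site → ℝ} {K' : (geomT D).Site → (geomT D).Site → ℝ}
    (h₂ : InL2Majorant (g := geomT (D.chart s)) (blkV1 hN (D.chart s)) T₂ S K)
    (hK : ∀ a b, K a b ≤ K' (blkMap D s a) (blkMap D s b)) (hK' : ∀ a b, 0 ≤ K' a b) :
    InL2Majorant (g := geomT D) (blkV1 hN D) (TB (-vch Mh k s) * T₂ * TB (vch Mh k s)) (blkMap D s '' S) K' :=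
  inL2Majorant_relabel (g₁ := geomT D) (g₂ := geomT (D.chart s)) (PBond.translateEquiv (vch Mh k s)) (blkMap D s)
    (blkMap_injective hMh hP s) (blkV1 hN D) (blkV1 hN (D.chart s))
    (fun b => blkV1_translate hN D hMh hP s b) (fun f b => conj_apply s T₂ f b)
    (fun a => ⟨fun ha => by
        obtain ⟨a', ha', he⟩ := (Set.mem_image _ _ _).1 ha
        rwa [← blkMap_injective hMh hP s he], fun ha => Set.mem_image_of_mem _ ha⟩)
    (fun y hy => by
        obtain ⟨a, _, he⟩ := (Set.mem_image _ _ _).1 hy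
        exact ⟨a, he⟩) h₂ hK hK'

end Torus

/-! ## §0b  Scaling and the sandwich `f·T·h` for block-`ℓ²` majorants (for the legs of (2.141) built on input-localised members) -/

section Generic

variable {g : B6.Geometry} {X : Type} [Fintype X]

omit [Fintype X] in
/-- `h·u` is supported where `u` is. [cite: Balaban1984PropagatorsII, (2.90)–(2.91) p.239 (bookkeeping, ours)] -/
private theorem mulOp_off (blk : X → g.Site) {h u : X → ℝ} {y' : g.Site} (hu : ∀ x, blk x ≠ y' → u x = 0) :
    ∀ x, blk x ≠ y' → mulOp h u x = 0 := fun x hx => by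
  rw [mulOp_apply, hu x hx, mul_zero]

/-- `‖h·u‖ ≤ ‖u‖` for `|h| ≤ 1`. [cite: Balaban1984PropagatorsII, (2.90)–(2.91) p.239 (bookkeeping, ours)] -/
private theorem l2n_mulOp_le {h : X → ℝ} (hle : ∀ x, |h x| ≤ 1) (u : X → ℝ) : l2n (mulOp h u) ≤ l2n u :=
  l2n_mono fun x => by
    rw [mulOp_apply, abs_mul]
    calc |h x| * |u x| ≤ 1 * |u x| := mul_le_mul_of_nonneg_right (hle x) (abs_nonneg _)
      _ = |u x| := one_mul _

/-- scaling: `s • T` has the block-`ℓ²` majorant `|s|·K`. [cite: Balaban1984PropagatorsII, (2.94) p.239, (2.140) p.247 (bookkeeping, ours)] -/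
theorem hasL2Majorant_smul (blk : X → g.Site) {T : Module.End ℝ (X → ℝ)} {K : g.Site → g.Site → ℝ} (h : HasL2Majorant blk T K) (s : ℝ) :
    HasL2Majorant blk (s • T) (fun a b => |s| * K a b) := by
  intro y y' u hu
  rw [LinearMap.smul_apply, blockPiece_smul, l2n_smul, mul_assoc]
  exact mul_le_mul_of_nonneg_left (h y y' u hu) (abs_nonneg s)

/-- **THE SANDWICH `f·T·h` WITH AN INPUT-LOCALISED MIDDLE FACTOR, IN `ℓ²`** (the shape of the terms of `∇∇(h_□G_□h_□)`): `T` with an input-localised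
block-`ℓ²` majorant `K ≥ 0` over `S` (outputs anywhere), `|f| ≤ s` supported over the blocks of `S`, `|h| ≤ 1` supported over the blocks of `S` ⟹ `f·T·h` has
the block-`ℓ²` majorant `1_S(y)·1_S(y′)·s·K(y,y′)` — the `ℓ²` twin of p38's `…B6Prop26LeftEntryKLevelV1.hasMajorant_sandwich_in`.
[cite: Balaban1984PropagatorsII, (2.141) p.247 (first leg), (2.90)–(2.91) p.239, (2.133) + (2.140) p.247; derivation ours] -/
theorem hasL2Majorant_sandwich_in (blk : X → g.Site) {T : Module.End ℝ (X → ℝ)} {f h : X → ℝ} {S : Set g.Site}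
    {K : g.Site → g.Site → ℝ} {s : ℝ} (hK : ∀ a b, 0 ≤ K a b) (hs : 0 ≤ s)
    (hfsupp : ∀ x, f x ≠ 0 → blk x ∈ S) (hfle : ∀ x, |f x| ≤ s)
    (hhsupp : ∀ x, h x ≠ 0 → blk x ∈ S) (hhle : ∀ x, |h x| ≤ 1) (hT : InL2Majorant blk T S K) :
    HasL2Majorant blk (mulOp f * T * mulOp h) (fun a b => ind S a * ind S b * (s * K a b)) := by
  intro y y' u hu
  beta_reduce
  have hnn : 0 ≤ ind S y * ind S y' * (s * K y y') * l2n u :=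
    mul_nonneg (mul_nonneg (mul_nonneg (ind_nonneg _ _) (ind_nonneg _ _)) (mul_nonneg hs (hK _ _))) (l2n_nonneg u)
  rw [Module.End.mul_apply, Module.End.mul_apply]
  by_cases hy' : y' ∈ S
  · by_cases hy : y ∈ S
    · rw [ind_of_mem hy, ind_of_mem hy', one_mul, one_mul]
      -- `‖Δ(y)(f·v)‖ ≤ s‖Δ(y)v‖`, `‖Δ(y)T(hu)‖ ≤ K‖hu‖ ≤ K‖u‖`
      have h1 : l2n (blockPiece blk y (mulOp f (T (mulOp h u)))) ≤ s * l2n (blockPiece blk y (T (mulOp h u))) := by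
        rw [← abs_of_nonneg hs, ← l2n_smul]
        refine l2n_mono fun x => ?_
        by_cases hx : blk x = y
        · simp only [blockPiece, hx, if_true, mulOp_apply, Pi.smul_apply, smul_eq_mul, abs_mul]
          exact mul_le_mul_of_nonneg_right ((hfle x).trans (le_abs_self s)) (abs_nonneg _)
        · simp [blockPiece, hx]
      have h2 := hT y y' hy' (mulOp h u) (mulOp_off blk hu)
      calc l2n (blockPiece blk y (mulOp f (T (mulOp h u)))) ≤ s * l2n (blockPiece blk y (T (mulOp h u))) := h1
        _ ≤ s * (K y y' * l2n (mulOp h u)) := mul_le_mul_of_nonneg_left h2 hs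
        _ ≤ s * (K y y' * l2n u) := mul_le_mul_of_nonneg_left (mul_le_mul_of_nonneg_left (l2n_mulOp_le hhle u) (hK _ _)) hs
        _ = s * K y y' * l2n u := by ring
    · -- no output in the block of `y`: `f` vanishes there
      have h0 : blockPiece blk y (mulOp f (T (mulOp h u))) = 0 := by
        funext x
        by_cases hx : blk x = y
        · have hfx : f x = 0 := by
            by_contra hne; exact hy (hx ▸ hfsupp x hne)
          simp [blockPiece, hx, mulOp_apply, hfx]
        · simp [blockPiece, hx]
      rw [h0, l2n_zero]; exact hnn
  · -- no input from the block of `y′`: `h·u = 0`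
    have h0 : mulOp h u = 0 := by
      funext x
      by_cases hx : blk x = y'
      · have hhx : h x = 0 := by
          by_contra hne; exact hy' (hx ▸ hhsupp x hne)
        simp [mulOp_apply, hhx]
      · simp [mulOp_apply, hu x hx]
    rw [h0, map_zero, map_zero]
    have h00 : blockPiece blk y (0 : X → ℝ) = 0 := by funext x; by_cases hx : blk x = y <;> simp [blockPiece, hx]
    rw [h00, l2n_zero]; exact hnn

end Generic

/-! ## §1  The band bridge for block-`ℓ²` majorants -/

section Bridge

variable {d L : ℕ} {hd : 1 ≤ d + 1} {hL : Odd L ∧ 1 < L} {a₀ a₁ : ℝ} (i : B6Prop25TwoScaleCensus.TSIdx d L hd hL a₀ a₁) {X : Type} [Fintype X]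

/-- **THE BAND BRIDGE IN `ℓ²`, INPUT-LOCALISED FORM**: let `T′` on the bond functions of `T_□` have the block-`ℓ²` majorant `A·e^{−δ|y−y′|_{T_□}}` (`j`-blocks),
let the window `W` (side `≤` the fine period) be charted injectively, let the global block distance be controlled by the flat distance on `W`, at most `n`
charted blocks over every global block, and let every window bond with block in `S` have its labels in the middle band.  Then `ε T′ ρ` has the INPUT-localised
block-`ℓ²` majorant `n²·A·e^{δ(κ+c)/(κC)}·e^{−(δ/(κC))·d}` over `S` (r03's `inMajorant_transplant_of_band` with `inL2Majorant_transplant`).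
[cite: Balaban1984PropagatorsII, (2.133) p.247, (2.140)–(2.141) p.247, p.238 (T_□ = □̃³); derivation ours] -/
theorem inL2Majorant_transplant_of_band (R M : ℝ) [DecidableEq X] {g : B6.Geometry}
    (blk : X → g.Site) (S : Set g.Site) (pos : X → Fin (d + 1) → ℤ) (dir : X → Fin (d + 1)) (x₀ : Fin (d + 1) → ℤ)
    {Wd : ℕ} (hWd : Wd ≤ i.P.sitesPerDir 0) (W : Finset X) (hW : ∀ x ∈ W, InWindow pos x₀ Wd x)
    (hinj : Set.InjOn (fun x => (pos x, dir x)) ↑W)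
    {T' : Module.End ℝ (PBond i.P 0 → ℝ)} {A δ : ℝ} (hA : 0 ≤ A) (hδ : 0 ≤ δ)
    (hT' : HasL2Majorant (g := B6Ineq2133TwoScaleV1.tsGeo i R M) (fun b : PBond i.P 0 => iterBlockOf i.j b.src) T'
      (fun y y' => A * Real.exp (-(δ * i.tdist y y'))))
    {C : ℕ} (hC : 1 ≤ C)
    (hband : ∀ x ∈ W, blk x ∈ S → ∀ μ, ((i.P.sitesPerDir i.j : ℕ) : ℤ) ≤ (C + 1) * ((pos x μ - x₀ μ) / ((L ^ i.j : ℕ) : ℤ) + 1) ∧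
      ((C : ℤ) + 1) * ((pos x μ - x₀ μ) / ((L ^ i.j : ℕ) : ℤ)) ≤ C * ((i.P.sitesPerDir i.j : ℕ) : ℤ))
    (κ c : ℝ) (hκ : 0 < κ)
    (hglob : ∀ x ∈ W, ∀ x₁ ∈ W, g.dist (blk x) (blk x₁) ≤ κ * (supNorm (pos x - pos x₁) / ((L ^ i.j : ℕ) : ℝ)) + c)
    (n : ℕ) (hfib : ∀ y : g.Site, ∃ T : Finset (Site i.P i.j), T.card ≤ n ∧
      ∀ x ∈ W, blk x = y → iterBlockOf i.j (chartBond i pos dir x₀ x).src ∈ T) :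
    InL2Majorant blk (transplant W (chartBond i pos dir x₀) T') S
      (fun a b => (n : ℝ) ^ 2 * ((A * Real.exp (δ * (κ + c) / (κ * C))) * Real.exp (-(δ / (κ * C) * g.dist a b)))) := by
  classical
  refine inL2Majorant_transplant (g' := B6Ineq2133TwoScaleV1.tsGeo i R M) blk (fun b : PBond i.P 0 => iterBlockOf i.j b.src) S
    (injOn_chartBond_full i pos dir x₀ hWd W hW hinj) hT' _ (fun a b => by positivity) (fun x hx x₁ hx₁ hx₁S => ?_) n hfib
  exact expKernel_of_supNorm_le hA hδ hC hκ
    (supNorm_div_le_of_band_right i R M pos dir x₀ hWd W hW hC hx hx₁ (hband x₁ hx₁ hx₁S)) (hglob x hx x₁ hx₁)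

end Bridge

/-! ## §2  Fired on the V1 global torus `T_η` with the full bond window `cB t x₀` -/

section V1

open LatticeFieldCalculus
open B6Prop25TwoScaleCensus (TSIdx)
open B6Ineq2133TwoScaleV1 (tsGeo)
open B6GlobalChartV1 (PV toBox blkV1)
open B6MultiLevelBoxOperator (N0)
open B6MultiLevelTorusOperator (TDomains)
open B6Geom246MultiLevelTorus (geomT)
open B4Reflection242 (boxDom)
open B6AgreeLapV1Chart (cB eB posV transplant_eB_eq)

variable {d ℓ : ℕ} {hd : 1 ≤ d + 1} {hL : Odd (ℓ + 1) ∧ 1 < ℓ + 1} {a₀ a₁ : ℝ} {m K : ℕ} {t : TSIdx d (ℓ + 1) hd hL a₀ a₁}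
variable {x₀ : Fin (d + 1) → ℤ} {hx₀ : ∀ μ, 0 ≤ x₀ μ} {hfit : ∀ μ, x₀ μ + (t.P.sitesPerDir 0 : ℕ) ≤ ((PV d ℓ m K hd hL).sitesPerDir 0 : ℕ)}
variable {Mh k R : ℕ} {P' : Fin (d + 1) → ℕ} (hN : ∀ μ, N0 ℓ Mh k P' μ = (PV d ℓ m K hd hL).sitesPerDir 0) (D : TDomains d ℓ Mh k P' R)

/-- **THE BAND BRIDGE ON `T_η` IN `ℓ²`, INPUT-LOCALISED FORM**: for a member operator `T′` with a block-`ℓ²` majorant `A·e^{−δ|y−y′|_{T_□}}`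
(`…B6RandomWalkL2TwoScaleMembers.ineq2140_DDG_TS` / `_DGD_TS` …), a corner `x₀ ≥ 0` with the full member period inside the box, `L^j ∣ x₀`, the full window
two-level (`j`, `j+1`), and a reach `S` all of whose window bonds have labels in the middle band (`C ≥ 1`): the full-window transplant `ε T′ ρ` has
`InL2Majorant (blkV1 hN D) (ε T′ ρ) S ((L^{d+1})²·A·e^{2δ/C}·e^{−(δ/((d+1)C))·d_T})` — inputs over `S`, outputs ANYWHERE (r03's `inDecay_window_V1` in `ℓ²`).
[cite: Balaban1984PropagatorsII, (2.133) p.247, (2.140)–(2.141) p.247, (2.90)–(2.91) p.239, p.238 (T_□ = □̃³)] -/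
theorem inL2Decay_window_V1 {T' : Module.End ℝ (PBond t.P 0 → ℝ)} {A δ : ℝ} (hA : 0 ≤ A) (hδ : 0 ≤ δ)
    (hT' : HasL2Majorant (g := tsGeo t 0 0) (fun b : PBond t.P 0 => iterBlockOf t.j b.src) T' (fun y y' => A * Real.exp (-(δ * t.tdist y y'))))
    (hMh : 1 ≤ Mh) (hP : ∀ μ, 1 ≤ P' μ) (hdiv : ∀ μ, (((ℓ + 1) ^ t.j : ℕ) : ℤ) ∣ x₀ μ)
    (hlev : ∀ z ∈ boxDom (N0 ℓ Mh k P'), (∀ μ, x₀ μ ≤ z μ ∧ z μ < x₀ μ + (t.P.sitesPerDir 0 : ℕ)) → t.j ≤ D.lev z ∧ D.lev z ≤ t.j + 1)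
    {C : ℕ} (hC : 1 ≤ C) (S : Set (geomT D).Site)
    (hband : ∀ b ∈ (cB t x₀ hx₀ hfit).W, blkV1 hN D b ∈ S → ∀ μ,
      ((t.P.sitesPerDir t.j : ℕ) : ℤ) ≤ (C + 1) * ((posV b μ - x₀ μ) / (((ℓ + 1) ^ t.j : ℕ) : ℤ) + 1) ∧
        ((C : ℤ) + 1) * ((posV b μ - x₀ μ) / (((ℓ + 1) ^ t.j : ℕ) : ℤ)) ≤ C * ((t.P.sitesPerDir t.j : ℕ) : ℤ)) :
    InL2Majorant (g := geomT D) (blkV1 hN D) (transplant (cB t x₀ hx₀ hfit).W (eB t x₀) T') S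
      (fun a b => (((ℓ + 1) ^ (d + 1) : ℕ) : ℝ) ^ 2 * ((A * Real.exp (δ * ((d + 1 : ℝ) + (d + 1)) / ((d + 1) * C))) *
        Real.exp (-(δ / ((d + 1) * C) * (geomT D).dist a b)))) := by
  classical
  rw [transplant_eB_eq]
  exact inL2Majorant_transplant_of_band t 0 0 (g := geomT D) (blkV1 hN D) S posV PBond.dir x₀ le_rfl (cB t x₀ hx₀ hfit).W
    (fun b hb => inWindow_of_mem_W hb) (injOn_posV_dir _) hA hδ hT' hC hband (d + 1) (d + 1) (by positivity)
    (hglob_W hN D hMh hP fun z hz hw => (hlev z hz hw).1) ((ℓ + 1) ^ (d + 1))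
    (fun y => hfib_sites_full t D.toDomains (fun b : PBond (PV d ℓ m K hd hL) 0 => toBox hN b.src) PBond.dir x₀ hdiv _ le_rfl hlev _
      (fun b hb => inWindow_of_mem_W hb) y)

end V1

end Literature.MathematicalPhysics.QuantumFieldTheory.Balaban1983to89.B6RandomWalkL2WindowV1
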